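/-
Copyright (c) 2026 the pub-hodgecm-mathlib formalisation cell (harness21).  Prover seat hodgecm-mathlib-K2E3-p21 (g4), Track B «K2-LIT» ∕ h413
(`stmt-HodgeConjecture-24833`), line `K2_E3_EllipticInputs`, road «FC-GL» (finite conjugation measure on `GL₃(F) ⧸ Z`, line lead K2E3-p23 (g4), RULINGS #1 (G1-1),
RULINGS #2 (G2-2) 2026-09-04T04:59Z), brick (GL-6) part 2 «BLOCK HENSEL ⇒ UNBOUNDED CENTRALISER» (the heads).  2026-09-04.
-/
import Summits.HodgeConjecture.HodgeConjecture.Theorems.K2E3GL3SpectralIdempotentCentralizer   -- (GL-6) part 1 (this seat): idempotent ⇒ unbounded centraliser; brings ★ FC-6a p857208 (strong Hensel, `χ_g`, `χ_g′`)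
import HarnessLib

/-!
# Crux `H413` — K2-LIT E3, road «FC-GL», brick (GL-6): a near-`(1|2)`-block-triangular `h ∈ GL₃(F)` whose isolated diagonal entry is separated from the
# complementary block has a SIMPLE RATIONAL EIGENVALUE, hence a non-trivial spectral idempotent in its centraliser, hence an UNBOUNDED centraliser

Cell `hodgecm-mathlib`, Track B, line `K2_E3_EllipticInputs`, road «FC-GL» of K2E3-p23 (g4) (CENSUS `CENSUS-SD-GL3Supercuspidal` (2) «BLOCK HENSEL», RULINGS #1
(G1-1) SHAPE I ∕ SHAPE II, RULINGS #2 (G2-2)): the contrapositive consumed by ★ `K2E3GL3ModCentre.exists_bound_of_isCompact_image` («compact centraliser mod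
centre ⇒ bounded `v(y_ij)·v(y⁻¹_i′j′)` on `Z_G(h)`»).  THEOREMS ONLY; count-neutral helper (`--supports stmt-HodgeConjecture-24833 --as helper`); no `σ`, no measure.

THE MATHEMATICS.  `F` a non-archimedean local field with `Valued F ℤᵐ⁰`, uniformizer `ϖ` (`v ϖ = exp(−1)`), `h ∈ GL₃(F)` with entries `≤ q^M`.
* §1–§2 = part 1 ★ `K2E3GL3SpectralIdempotentCentralizer` (simple rational root ⇒ idempotent `e ≠ 0, 1` in `Z(h)` ⇒ unbounded pencil `ϖⁿ e + (1 − e)`).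
* §3 **BLOCK HENSEL** (SHAPE I = row `0` small: `|h₀₁|, |h₀₂| ≤ q^{M−d}`; separation `|(h₀₀−h₁₁)(h₀₀−h₂₂) − h₁₂h₂₁| ≥ q^{−k}`; `d ≥ 4M + 2k + 1`): `|χ_h(h₀₀)| ≤ q^{3M−d}`
  (every term of ★ `eval_charpoly_fin_three` off the main product carries `h₀₁` or `h₀₂`) and `|χ_h′(h₀₀)| = |(h₀₀−h₁₁)(h₀₀−h₂₂) − h₁₂h₂₁| ≥ q^{−k}` (★
  `eval_derivative_charpoly_fin_three`; the correction `h₀₁h₁₀ + h₀₂h₂₀` is `≤ q^{2M−d}`); ★ strong Hensel (`exists_isRoot_of_v_eval_lt_sq`) for the rescaled cubic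
  `ϖ^{3M}χ_h(ϖ^{−M}y)` at `ϖ^M h₀₀` (as in ★ FC-6a) gives a root `λ₀` with `|λ₀ − h₀₀| ≤ q^{3M+k−d}`, SIMPLE because `|χ′(λ₀) − χ′(h₀₀)| ≤ q^{4M+k−d} < q^{−k}`.
  SHAPE II (column `2` small) is SHAPE I for the re-indexed transpose `(hᵀ)^{(0 2)}`, which has the same characteristic polynomial.
* §4 THE HEADS `exists_centralizer_unbounded_of_block_separated` (SHAPE I) and `…_of_block_separated'` (SHAPE II): `∀ N, ∃ y ∈ GL₃(F)`, `y h = h y`,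
  `∃ i j i′ j′, exp N < v(y_{ij})·v(y⁻¹_{i′j′})` (constants `c₁ = 4, c₂ = 2, c₃ = 1`; the `hdet` binder of the announced shape is not needed and dropped).

HONEST LABEL: HC_CM is proved only modulo the 7 printed citations (2 remaining named inputs: hLiu418 = stmt-HodgeConjecture-24832, h413 =
stmt-HodgeConjecture-24833) until rung 0 closes; elementary, closes no organ by itself (road «FC-GL» is the (S-D) supercuspidal-`GL₃` input of row 11).

## References
* [NeukirchANT1999] J. Neukirch, *Algebraic Number Theory* (1999), Ch. II §4 Lemma (4.6) (Hensel's lemma, strong form).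
* [HarishChandra1970] Harish-Chandra (notes by G. van Dijk), *Harmonic Analysis on Reductive p-adic Groups*, LNM 162 (1970), Part VI §8 (compactness of
  centralisers of elliptic elements; the split case has non-compact centraliser).
-/

set_option autoImplicit false
-- the mandated namespace repeats `HodgeConjecture.HodgeConjecture`, as in every `Theorems/*.lean` of this sub-problem
set_option linter.dupNamespace false

noncomputable section

open Polynomial Matrix
open scoped WithZero ValuativeRel MatrixGroups
open Literature.NumberTheory.Automorphic
open Literature.NumberTheory.GaloisRepresentations Literature.NumberTheory.GaloisRepresentations.IsNonarchimedeanLocalField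
open Summit.HodgeConjecture.HodgeConjecture.Cruxes.H413.K2E3NearTriangularEigenvalues
open Summit.HodgeConjecture.HodgeConjecture.Cruxes.H413.K2E3GL3SpectralIdempotentCentralizer

namespace Summit.HodgeConjecture.HodgeConjecture.Cruxes.H413.K2E3GL3BlockHenselCentralizer

/-! ## §3  Block Hensel: a simple rational root of `χ_h` for row-`0`-small, block-separated `h` -/

section Hensel

variable {K : Type*} [Field K] [Valued K ℤᵐ⁰] [ValuativeRel K] [(Valued.v : Valuation K ℤᵐ⁰).Compatible] [IsNonarchimedeanLocalField K]

set_option maxHeartbeats 800000 in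
-- one long chain of valuation estimates (as in ★ FC-6a)
/-- **BLOCK HENSEL (row `0` small).**  `g ∈ 𝔤𝔩₃(F)` with entries `≤ q^M`, `|g₀₁|, |g₀₂| ≤ q^{M−d}`, `|(g₀₀−g₁₁)(g₀₀−g₂₂) − g₁₂g₂₁| ≥ q^{−k}` (the isolated diagonal entry is not
an approximate eigenvalue of the complementary `2 × 2` block) and `d ≥ 4M + 2k + 1` ⟹ `χ_g` has a SIMPLE root `λ₀ ∈ F` with `|λ₀ − g₀₀| ≤ q^{3M+k−d}`.
[cite: NeukirchANT1999, Ch. II §4 Lemma (4.6)] [cite: HarishChandra1970, Part VI §8 p. 60] -/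
theorem exists_simple_root_of_row_zero_small {ϖ : K} (hϖ : Valued.v ϖ = WithZero.exp (-1 : ℤ))
    (g : Matrix (Fin 3) (Fin 3) K) {M k d : ℕ} (hd : 4 * M + 2 * k + 1 ≤ d)
    (hall : ∀ i j, Valued.v (g i j) ≤ WithZero.exp (M : ℤ))
    (h01 : Valued.v (g 0 1) ≤ WithZero.exp ((M : ℤ) - d)) (h02 : Valued.v (g 0 2) ≤ WithZero.exp ((M : ℤ) - d))
    (hsep : WithZero.exp (-(k : ℤ)) ≤ Valued.v ((g 0 0 - g 1 1) * (g 0 0 - g 2 2) - g 1 2 * g 2 1)) :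
    ∃ l₀ : K, g.charpoly.IsRoot l₀ ∧ g.charpoly.derivative.eval l₀ ≠ 0 ∧ Valued.v (l₀ - g 0 0) ≤ WithZero.exp (3 * (M : ℤ) + k - d) := by
  classical
  set v : Valuation K ℤᵐ⁰ := Valued.v with hvdef
  set p := g.charpoly with hp
  have hMd : ∀ {x : K} {e : ℤ}, v x ≤ WithZero.exp e → ∀ {e' : ℤ}, e ≤ e' → v x ≤ WithZero.exp e' :=
    fun h _ hee => h.trans (WithZero.exp_le_exp.2 hee)
  have hdiff : ∀ i j, v (g i i - g j j) ≤ WithZero.exp (M : ℤ) := fun i j => v.map_sub_le (hall i i) (hall j j)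
  have hmul3 : ∀ {x y z : K} {a b c : ℤ}, v x ≤ WithZero.exp a → v y ≤ WithZero.exp b → v z ≤ WithZero.exp c →
      v (x * y * z) ≤ WithZero.exp (a + b + c) := by
    intro x y z a b c hx hy hz
    rw [map_mul, map_mul, WithZero.exp_add, WithZero.exp_add]
    exact mul_le_mul' (mul_le_mul' hx hy) hz
  have h2 : ∀ {x y : K} {a b : ℤ}, v x ≤ WithZero.exp a → v y ≤ WithZero.exp b → v (x * y) ≤ WithZero.exp (a + b) := by
    intro x y a b hx hy; rw [map_mul, WithZero.exp_add]; exact mul_le_mul' hx hy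
  -- (1) `|p(g₀₀)| ≤ q^{3M−d}`
  have hpval : v (p.eval (g 0 0)) ≤ WithZero.exp (3 * (M : ℤ) - d) := by
    have hE0 : p.eval (g 0 0) = -(g 0 2 * g 2 0 * (g 0 0 - g 1 1)) - g 0 1 * g 1 0 * (g 0 0 - g 2 2) - g 0 1 * g 1 2 * g 2 0 - g 0 2 * g 1 0 * g 2 1 := by
      rw [hp, eval_charpoly_fin_three]; ring
    rw [hE0]
    refine v.map_sub_le (v.map_sub_le (v.map_sub_le ?_ ?_) ?_) ?_
    · rw [Valuation.map_neg]; exact hMd (hmul3 h02 (hall 2 0) (hdiff 0 1)) (by omega)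
    · exact hMd (hmul3 h01 (hall 1 0) (hdiff 0 2)) (by omega)
    · exact hMd (hmul3 h01 (hall 1 2) (hall 2 0)) (by omega)
    · exact hMd (hmul3 h02 (hall 1 0) (hall 2 1)) (by omega)
  -- `|p′(g₀₀)| = |Q| ∈ [q^{−k}, q^{2M}]`, `Q = (g₀₀−g₁₁)(g₀₀−g₂₂) − g₁₂g₂₁`
  have hQhi : v ((g 0 0 - g 1 1) * (g 0 0 - g 2 2) - g 1 2 * g 2 1) ≤ WithZero.exp (2 * (M : ℤ)) := by
    rw [two_mul]
    exact v.map_sub_le (h2 (hdiff 0 1) (hdiff 0 2)) (h2 (hall 1 2) (hall 2 1))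
  have hderiv : p.derivative.eval (g 0 0) = ((g 0 0 - g 1 1) * (g 0 0 - g 2 2) - g 1 2 * g 2 1) - (g 0 1 * g 1 0 + g 0 2 * g 2 0) := by
    rw [hp, eval_derivative_charpoly_fin_three]; ring
  have hS : v (g 0 1 * g 1 0 + g 0 2 * g 2 0) ≤ WithZero.exp (2 * (M : ℤ) - d) :=
    v.map_add_le (hMd (h2 h01 (hall 1 0)) (by omega)) (hMd (h2 h02 (hall 2 0)) (by omega))
  have hdval : WithZero.exp (-(k : ℤ)) ≤ v (p.derivative.eval (g 0 0)) ∧ v (p.derivative.eval (g 0 0)) ≤ WithZero.exp (2 * (M : ℤ)) := by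
    have hSlt : v (g 0 1 * g 1 0 + g 0 2 * g 2 0) < v ((g 0 0 - g 1 1) * (g 0 0 - g 2 2) - g 1 2 * g 2 1) :=
      lt_of_le_of_lt hS (lt_of_lt_of_le (WithZero.exp_lt_exp.2 (by omega)) hsep)
    have heq : v (p.derivative.eval (g 0 0)) = v ((g 0 0 - g 1 1) * (g 0 0 - g 2 2) - g 1 2 * g 2 1) := by
      rw [hderiv, sub_eq_add_neg]
      exact v.map_add_eq_of_lt_left (by rwa [Valuation.map_neg])
    rw [heq]; exact ⟨hsep, hQhi⟩
  -- (2) the rescaled cubic `pt(y) = c⁻³ p(c y)`, `c = ϖ^{-M}` (as in ★ FC-6a)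
  obtain ⟨hvc, hϖM⟩ := v_inv_pow_uniformizer hϖ M
  set c : K := (ϖ ^ M)⁻¹ with hc
  have hc0 : c ≠ 0 := inv_ne_zero hϖM
  have hvc' : v c = WithZero.exp (M : ℤ) := hvc
  set e₁ : K := g.trace with he₁
  set e₂ : K := g.adjugate.trace with he₂
  set e₃ : K := g.det with he₃
  have hpform : p = X ^ 3 - C e₁ * X ^ 2 + C e₂ * X - C e₃ := by
    rw [hp, Literature.LinearAlgebra.Matrix.CharpolyBlockPatterns.charpoly_fin_three_trace_adjugate]
  set pt : K[X] := X ^ 3 + C (-(e₁ / c)) * X ^ 2 + C (e₂ / c ^ 2) * X + C (-(e₃ / c ^ 3)) with hpt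
  have hpt_eval : ∀ y, pt.eval y = c⁻¹ ^ 3 * p.eval (c * y) := by
    intro y
    rw [hpform]
    simp only [hpt, eval_add, eval_sub, eval_mul, eval_pow, eval_C, eval_X]
    field_simp
    ring
  have hpt_deriv : ∀ y, pt.derivative.eval y = c⁻¹ ^ 2 * p.derivative.eval (c * y) := by
    intro y
    rw [hpform]
    simp only [hpt, derivative_add, derivative_sub, derivative_mul, derivative_X_pow, derivative_C, derivative_X, eval_add, eval_sub, eval_mul, eval_pow, eval_C, eval_X,
      zero_mul, mul_one, zero_add, add_zero, sub_zero]
    push_cast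
    field_simp
    ring
  have he₁v : v e₁ ≤ WithZero.exp (M : ℤ) := by
    rw [he₁, trace_fin_three]; exact v.map_add_le (v.map_add_le (hall 0 0) (hall 1 1)) (hall 2 2)
  have h2M : ∀ {x y : K}, v x ≤ WithZero.exp (M : ℤ) → v y ≤ WithZero.exp (M : ℤ) → v (x * y) ≤ WithZero.exp (2 * (M : ℤ)) := by
    intro x y hx hy; rw [map_mul, two_mul, WithZero.exp_add]; exact mul_le_mul' hx hy
  have he₂v : v e₂ ≤ WithZero.exp (2 * (M : ℤ)) := by
    rw [he₂, adjugate_fin_three, trace_fin_three]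
    simp only [of_apply, cons_val', cons_val_zero, cons_val_one, cons_val_two, empty_val', cons_val_fin_one]
    refine v.map_add_le (v.map_add_le (v.map_sub_le (h2M (hall 1 1) (hall 2 2)) (h2M (hall 1 2) (hall 2 1)))
      (v.map_sub_le (h2M (hall 0 0) (hall 2 2)) (h2M (hall 0 2) (hall 2 0)))) (v.map_sub_le (h2M (hall 0 0) (hall 1 1)) (h2M (hall 0 1) (hall 1 0)))
  have he₃v : v e₃ ≤ WithZero.exp (3 * (M : ℤ)) := by
    rw [he₃, det_fin_three]
    have h3 : ∀ a b c' : Fin 3 × Fin 3, v (g a.1 a.2 * g b.1 b.2 * g c'.1 c'.2) ≤ WithZero.exp (3 * (M : ℤ)) := by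
      intro a b c'
      rw [show (3 * (M : ℤ)) = (M : ℤ) + M + M by ring]
      exact hmul3 (hall _ _) (hall _ _) (hall _ _)
    refine v.map_sub_le (v.map_add_le (v.map_add_le (v.map_sub_le (v.map_sub_le (h3 (0,0) (1,1) (2,2)) (h3 (0,0) (1,2) (2,1))) (h3 (0,1) (1,0) (2,2)))
      (h3 (0,1) (1,2) (2,0))) (h3 (0,2) (1,0) (2,1))) (h3 (0,2) (1,1) (2,0))
  have hcinv : ∀ n : ℕ, v (c ^ n)⁻¹ = WithZero.exp (-((n : ℤ) * M)) := by
    intro n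
    rw [map_inv₀, map_pow, hvc', ← WithZero.exp_nsmul, ← WithZero.exp_neg]
    congr 1
  have hdivle : ∀ {x : K} {n : ℕ}, v x ≤ WithZero.exp ((n : ℤ) * M) → v (x / c ^ n) ≤ 1 := by
    intro x n hx
    rw [div_eq_mul_inv, map_mul, hcinv, ← WithZero.exp_zero]
    calc v x * WithZero.exp (-((n : ℤ) * M)) ≤ WithZero.exp ((n : ℤ) * M) * WithZero.exp (-((n : ℤ) * M)) := mul_le_mul' hx le_rfl
      _ = WithZero.exp 0 := by rw [← WithZero.exp_add]; congr 1; ring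
  have hdivle1 : ∀ {x : K}, v x ≤ WithZero.exp (M : ℤ) → v (x / c) ≤ 1 := by
    intro x hx
    have h := hdivle (x := x) (n := 1) (by simpa using hx)
    rwa [pow_one] at h
  have hptcoeff : ∀ n, v (pt.coeff n) ≤ 1 := by
    have hc1 : v (-(e₁ / c)) ≤ 1 := by rw [Valuation.map_neg]; exact hdivle1 he₁v
    have hc2 : v (e₂ / c ^ 2) ≤ 1 := hdivle (n := 2) (by simpa using he₂v)
    have hc3 : v (-(e₃ / c ^ 3)) ≤ 1 := by rw [Valuation.map_neg]; exact hdivle (n := 3) (by simpa using he₃v)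
    have hk0 : pt.coeff 0 = -(e₃ / c ^ 3) := by simp [hpt]
    have hk1 : pt.coeff 1 = e₂ / c ^ 2 := by simp [hpt]
    have hk2 : pt.coeff 2 = -(e₁ / c) := by simp [hpt]
    have hk3 : pt.coeff 3 = 1 := by simp [hpt]
    have hk4 : ∀ n, pt.coeff (n + 4) = 0 := by intro n; simp [hpt]
    intro n
    rcases n with _ | _ | _ | _ | n
    · rw [hk0]; exact hc3
    · rw [hk1]; exact hc2
    · rw [hk2]; exact hc1
    · rw [hk3, map_one]
    · rw [hk4, map_zero]; exact bot_le
  -- (3) strong Hensel at `ã = g₀₀ / c`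
  have hai : v (g 0 0 / c) ≤ 1 := hdivle1 (hall 0 0)
  obtain ⟨hdlo, hdhi⟩ := hdval
  have hcy : c * (g 0 0 / c) = g 0 0 := by field_simp
  have hev : v (pt.eval (g 0 0 / c)) ≤ WithZero.exp (-(d : ℤ)) := by
    rw [hpt_eval, hcy, map_mul, map_pow, show c⁻¹ = (c ^ 1)⁻¹ by rw [pow_one], hcinv]
    calc WithZero.exp (-((1 : ℕ) * (M : ℤ))) ^ 3 * v (p.eval (g 0 0))
        ≤ WithZero.exp (-((1 : ℕ) * (M : ℤ))) ^ 3 * WithZero.exp (3 * (M : ℤ) - d) := mul_le_mul' le_rfl hpval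
      _ = WithZero.exp (-(d : ℤ)) := by rw [← WithZero.exp_nsmul, ← WithZero.exp_add]; congr 1; simp; ring
  have hed : WithZero.exp (-(2 * (M : ℤ)) - k) ≤ v (pt.derivative.eval (g 0 0 / c)) := by
    rw [hpt_deriv, hcy, map_mul, map_pow, show c⁻¹ = (c ^ 1)⁻¹ by rw [pow_one], hcinv]
    calc WithZero.exp (-(2 * (M : ℤ)) - k) = WithZero.exp (-((1 : ℕ) * (M : ℤ))) ^ 2 * WithZero.exp (-(k : ℤ)) := by
          rw [← WithZero.exp_nsmul, ← WithZero.exp_add]; congr 1; simp; ring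
      _ ≤ WithZero.exp (-((1 : ℕ) * (M : ℤ))) ^ 2 * v (p.derivative.eval (g 0 0)) := mul_le_mul' le_rfl hdlo
  have hlt : v (pt.eval (g 0 0 / c)) < v (pt.derivative.eval (g 0 0 / c)) ^ 2 := by
    refine lt_of_le_of_lt hev (lt_of_lt_of_le ?_ (pow_le_pow_left' hed 2))
    rw [← WithZero.exp_nsmul, WithZero.exp_lt_exp]; simp; omega
  obtain ⟨t, htroot, htb⟩ := exists_isRoot_of_v_eval_lt_sq pt hptcoeff (g 0 0 / c) hai hlt
  -- the root `λ₀ = c t` of `p` and its distance to `g₀₀`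
  have hl₀root : p.IsRoot (c * t) := by
    have := hpt_eval t
    rw [htroot.eq_zero] at this
    rw [IsRoot.def]
    exact (mul_eq_zero.1 this.symm).resolve_left (pow_ne_zero 3 (inv_ne_zero hc0))
  have hl₀near : v (c * t - g 0 0) ≤ WithZero.exp (3 * (M : ℤ) + k - d) := by
    have hne : v (pt.derivative.eval (g 0 0 / c)) ≠ 0 := ne_of_gt (lt_of_lt_of_le WithZero.exp_pos hed)
    have ht1 : v (t - g 0 0 / c) ≤ v (pt.eval (g 0 0 / c)) * (v (pt.derivative.eval (g 0 0 / c)))⁻¹ := by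
      rw [le_mul_inv_iff₀ (pos_iff_ne_zero.2 hne)]; exact htb
    have hct : c * t - g 0 0 = c * (t - g 0 0 / c) := by field_simp
    rw [hct, map_mul, hvc']
    calc WithZero.exp (M : ℤ) * v (t - g 0 0 / c)
        ≤ WithZero.exp (M : ℤ) * (WithZero.exp (-(d : ℤ)) * (WithZero.exp (-(2 * (M : ℤ)) - k))⁻¹) := by
          refine mul_le_mul' le_rfl (ht1.trans ?_)
          exact mul_le_mul' hev (inv_anti₀ WithZero.exp_pos hed)
      _ = WithZero.exp (3 * (M : ℤ) + k - d) := by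
          rw [← WithZero.exp_neg, ← WithZero.exp_add, ← WithZero.exp_add]; congr 1; ring
  -- SIMPLICITY: `p′(λ₀) − p′(g₀₀) = (λ₀ − g₀₀)(3(λ₀ + g₀₀) − 2e₁)` is `≤ q^{4M+k−d} < q^{−k} ≤ |p′(g₀₀)|`
  refine ⟨c * t, hl₀root, ?_, hl₀near⟩
  have hdiff' : p.derivative.eval (c * t) - p.derivative.eval (g 0 0) = (c * t - g 0 0) * (3 * (c * t + g 0 0) - 2 * e₁) := by
    rw [hpform]
    simp only [derivative_add, derivative_sub, derivative_mul, derivative_X_pow, derivative_C, derivative_X, eval_add, eval_sub, eval_mul, eval_pow, eval_C, eval_X,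
      zero_mul, mul_one, zero_add, sub_zero]
    push_cast
    ring
  have hnat : ∀ m : ℕ, v (m : K) ≤ 1 := fun m => by
    rw [hvdef, Literature.NumberTheory.Automorphic.v_le_one_iff_mem_integer]; exact (m : 𝒪[K]).2
  have hsum : v (c * t + g 0 0) ≤ WithZero.exp (M : ℤ) := by
    have : c * t + g 0 0 = (c * t - g 0 0) + 2 * g 0 0 := by ring
    rw [this]
    refine v.map_add_le (hMd hl₀near (by omega)) ?_
    rw [map_mul, show (2 : K) = ((2 : ℕ) : K) by norm_num]
    calc v ((2 : ℕ) : K) * v (g 0 0) ≤ 1 * WithZero.exp (M : ℤ) := mul_le_mul' (hnat 2) (hall 0 0)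
      _ = WithZero.exp (M : ℤ) := one_mul _
  have hfac : v (3 * (c * t + g 0 0) - 2 * e₁) ≤ WithZero.exp (M : ℤ) := by
    refine v.map_sub_le ?_ ?_
    · rw [map_mul, show (3 : K) = ((3 : ℕ) : K) by norm_num]
      calc v ((3 : ℕ) : K) * v (c * t + g 0 0) ≤ 1 * WithZero.exp (M : ℤ) := mul_le_mul' (hnat 3) hsum
        _ = WithZero.exp (M : ℤ) := one_mul _
    · rw [map_mul, show (2 : K) = ((2 : ℕ) : K) by norm_num]
      calc v ((2 : ℕ) : K) * v e₁ ≤ 1 * WithZero.exp (M : ℤ) := mul_le_mul' (hnat 2) he₁v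
        _ = WithZero.exp (M : ℤ) := one_mul _
  have hsmall : v (p.derivative.eval (c * t) - p.derivative.eval (g 0 0)) < v (p.derivative.eval (g 0 0)) := by
    rw [hdiff', map_mul]
    calc v (c * t - g 0 0) * v (3 * (c * t + g 0 0) - 2 * e₁) ≤ WithZero.exp (3 * (M : ℤ) + k - d) * WithZero.exp (M : ℤ) := mul_le_mul' hl₀near hfac
      _ = WithZero.exp (4 * (M : ℤ) + k - d) := by rw [← WithZero.exp_add]; congr 1; ring
      _ < WithZero.exp (-(k : ℤ)) := WithZero.exp_lt_exp.2 (by omega)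
      _ ≤ v (p.derivative.eval (g 0 0)) := hdlo
  intro h0
  have : v (p.derivative.eval (c * t) - p.derivative.eval (g 0 0)) = v (p.derivative.eval (g 0 0)) := by
    rw [h0, zero_sub, Valuation.map_neg]
  exact absurd this (ne_of_lt hsmall)

end Hensel

/-! ## §4  The heads (SHAPE I: row `0` small; SHAPE II: column `2` small) -/

section Heads

variable {F : Type*} [Field F] [Valued F ℤᵐ⁰] [ValuativeRel F] [(Valued.v : Valuation F ℤᵐ⁰).Compatible] [IsNonarchimedeanLocalField F] [CharZero F]

omit [CharZero F] in
/-- **(GL-6) SHAPE I «BLOCK HENSEL ⇒ UNBOUNDED CENTRALISER».**  For `h ∈ GL₃(F)` with entries `≤ q^M`, `|h₀₁|, |h₀₂| ≤ q^{M−d}`,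
`|(h₀₀−h₁₁)(h₀₀−h₂₂) − h₁₂h₂₁| ≥ q^{−k}` and `d ≥ 4M + 2k + 1`, the centraliser of `h` is unbounded: `∀ N, ∃ y ∈ Z(h), ∃ i j i′ j′, exp N < v(y_{ij})·v(y⁻¹_{i′j′})`
— `h` has a simple rational eigenvalue (§3), hence a non-trivial spectral idempotent in its centraliser (§1), hence the unbounded pencil `ϖⁿ e + (1 − e)` (§2); `h`
is not scalar because the separation quadratic of a scalar matrix vanishes.  (Constants `c₁ = 4, c₂ = 2, c₃ = 1`; no determinant hypothesis needed.)
[cite: HarishChandra1970, Part VI §8 p. 60] [cite: NeukirchANT1999, Ch. II §4 Lemma (4.6)] -/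
theorem exists_centralizer_unbounded_of_block_separated {ϖ : F} (hϖ : Valued.v ϖ = WithZero.exp (-1 : ℤ)) {M k d : ℕ} (hd : 4 * M + 2 * k + 1 ≤ d)
    (h : GL (Fin 3) F) (hall : ∀ i j, Valued.v ((h : Matrix (Fin 3) (Fin 3) F) i j) ≤ WithZero.exp (M : ℤ))
    (h01 : Valued.v ((h : Matrix (Fin 3) (Fin 3) F) 0 1) ≤ WithZero.exp ((M : ℤ) - d)) (h02 : Valued.v ((h : Matrix (Fin 3) (Fin 3) F) 0 2) ≤ WithZero.exp ((M : ℤ) - d))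
    (hsep : WithZero.exp (-(k : ℤ)) ≤ Valued.v (((h : Matrix (Fin 3) (Fin 3) F) 0 0 - (h : Matrix (Fin 3) (Fin 3) F) 1 1) *
      ((h : Matrix (Fin 3) (Fin 3) F) 0 0 - (h : Matrix (Fin 3) (Fin 3) F) 2 2) - (h : Matrix (Fin 3) (Fin 3) F) 1 2 * (h : Matrix (Fin 3) (Fin 3) F) 2 1)) :
    ∀ N : ℕ, ∃ y : GL (Fin 3) F, y * h = h * y ∧ ∃ i j i' j' : Fin 3,
      WithZero.exp (N : ℤ) < Valued.v ((y : Matrix (Fin 3) (Fin 3) F) i j) * Valued.v (((y⁻¹ : GL (Fin 3) F) : Matrix (Fin 3) (Fin 3) F) i' j') := by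
  intro N
  obtain ⟨l₀, hroot, hsimple, -⟩ := exists_simple_root_of_row_zero_small hϖ (h : Matrix (Fin 3) (Fin 3) F) hd hall h01 h02 hsep
  obtain ⟨e, he, hhe, he0, he1⟩ := exists_idempotent_of_simple_root (h : Matrix (Fin 3) (Fin 3) F) hroot hsimple
  refine exists_centralizer_unbounded_of_idempotent hϖ h he hhe he0 (fun h1 => ?_) N
  -- `e = 1 ⇒ h = λ₀·1 ⇒` the separation quadratic vanishes
  have hscal := he1 h1
  have hq : ((h : Matrix (Fin 3) (Fin 3) F) 0 0 - (h : Matrix (Fin 3) (Fin 3) F) 1 1) * ((h : Matrix (Fin 3) (Fin 3) F) 0 0 - (h : Matrix (Fin 3) (Fin 3) F) 2 2) -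
      (h : Matrix (Fin 3) (Fin 3) F) 1 2 * (h : Matrix (Fin 3) (Fin 3) F) 2 1 = 0 := by
    rw [hscal]; simp [Matrix.algebraMap_matrix_apply]
  rw [hq, map_zero] at hsep
  exact absurd hsep (not_le.2 WithZero.exp_pos)

omit [CharZero F] in
/-- **(GL-6) SHAPE II** (column `2` small: `|h₀₂|, |h₁₂| ≤ q^{M−d}`, separation `|(h₂₂−h₀₀)(h₂₂−h₁₁) − h₀₁h₁₀| ≥ q^{−k}`): the same conclusion — SHAPE I for the re-indexed
transpose `X ↦ (Xᵀ)^{(0 2)}`, which has the same characteristic polynomial (★ `charpoly_transpose`, `charpoly_reindex`). [cite: HarishChandra1970, Part VI §8 p. 60] -/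
theorem exists_centralizer_unbounded_of_block_separated' {ϖ : F} (hϖ : Valued.v ϖ = WithZero.exp (-1 : ℤ)) {M k d : ℕ} (hd : 4 * M + 2 * k + 1 ≤ d)
    (h : GL (Fin 3) F) (hall : ∀ i j, Valued.v ((h : Matrix (Fin 3) (Fin 3) F) i j) ≤ WithZero.exp (M : ℤ))
    (h02 : Valued.v ((h : Matrix (Fin 3) (Fin 3) F) 0 2) ≤ WithZero.exp ((M : ℤ) - d)) (h12 : Valued.v ((h : Matrix (Fin 3) (Fin 3) F) 1 2) ≤ WithZero.exp ((M : ℤ) - d))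
    (hsep : WithZero.exp (-(k : ℤ)) ≤ Valued.v (((h : Matrix (Fin 3) (Fin 3) F) 2 2 - (h : Matrix (Fin 3) (Fin 3) F) 0 0) *
      ((h : Matrix (Fin 3) (Fin 3) F) 2 2 - (h : Matrix (Fin 3) (Fin 3) F) 1 1) - (h : Matrix (Fin 3) (Fin 3) F) 0 1 * (h : Matrix (Fin 3) (Fin 3) F) 1 0)) :
    ∀ N : ℕ, ∃ y : GL (Fin 3) F, y * h = h * y ∧ ∃ i j i' j' : Fin 3,
      WithZero.exp (N : ℤ) < Valued.v ((y : Matrix (Fin 3) (Fin 3) F) i j) * Valued.v (((y⁻¹ : GL (Fin 3) F) : Matrix (Fin 3) (Fin 3) F) i' j') := by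
  intro N
  -- the re-indexed transpose `g = (hᵀ)^{σ}`, `σ = (0 2)`: row `0` of `g` is `(h₂₂, h₁₂, h₀₂)`
  set σ : Fin 3 ≃ Fin 3 := Equiv.swap 0 2 with hσ
  set g : Matrix (Fin 3) (Fin 3) F := Matrix.reindex σ σ (h : Matrix (Fin 3) (Fin 3) F)ᵀ with hg
  have hσs : σ.symm = σ := by rw [hσ, Equiv.symm_swap]
  have hgij : ∀ i j, g i j = (h : Matrix (Fin 3) (Fin 3) F) (σ j) (σ i) := fun i j => by
    simp [hg, Matrix.reindex_apply, Matrix.transpose_apply, hσs]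
  have hσ0 : σ 0 = 2 := by simp [hσ]
  have hσ1 : σ 1 = 1 := by simp [hσ, Equiv.swap_apply_of_ne_of_ne]
  have hσ2 : σ 2 = 0 := by simp [hσ]
  have hchar : g.charpoly = (h : Matrix (Fin 3) (Fin 3) F).charpoly := by rw [hg, charpoly_reindex, charpoly_transpose]
  have hall' : ∀ i j, Valued.v (g i j) ≤ WithZero.exp (M : ℤ) := fun i j => by rw [hgij]; exact hall _ _
  have h01' : Valued.v (g 0 1) ≤ WithZero.exp ((M : ℤ) - d) := by rw [hgij, hσ0, hσ1]; exact h12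
  have h02' : Valued.v (g 0 2) ≤ WithZero.exp ((M : ℤ) - d) := by rw [hgij, hσ0, hσ2]; exact h02
  have hsep' : WithZero.exp (-(k : ℤ)) ≤ Valued.v ((g 0 0 - g 1 1) * (g 0 0 - g 2 2) - g 1 2 * g 2 1) := by
    simp only [hgij, hσ0, hσ1, hσ2]
    rw [mul_comm (((h : Matrix (Fin 3) (Fin 3) F) 2 2 - (h : Matrix (Fin 3) (Fin 3) F) 1 1))]
    exact hsep
  obtain ⟨l₀, hroot, hsimple, -⟩ := exists_simple_root_of_row_zero_small hϖ g hd hall' h01' h02' hsep'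
  rw [hchar] at hroot hsimple
  obtain ⟨e, he, hhe, he0, he1⟩ := exists_idempotent_of_simple_root (h : Matrix (Fin 3) (Fin 3) F) hroot hsimple
  refine exists_centralizer_unbounded_of_idempotent hϖ h he hhe he0 (fun h1 => ?_) N
  have hscal := he1 h1
  have hq : ((h : Matrix (Fin 3) (Fin 3) F) 2 2 - (h : Matrix (Fin 3) (Fin 3) F) 0 0) * ((h : Matrix (Fin 3) (Fin 3) F) 2 2 - (h : Matrix (Fin 3) (Fin 3) F) 1 1) -
      (h : Matrix (Fin 3) (Fin 3) F) 0 1 * (h : Matrix (Fin 3) (Fin 3) F) 1 0 = 0 := by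
    rw [hscal]; simp [Matrix.algebraMap_matrix_apply]
  rw [hq, map_zero] at hsep
  exact absurd hsep (not_le.2 WithZero.exp_pos)

end Heads

end Summit.HodgeConjecture.HodgeConjecture.Cruxes.H413.K2E3GL3BlockHenselCentralizer

end
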